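import Summits.ABC.StewartYu.ArchG3StartRec
import Summits.ABC.StewartYu.ArchG3PackClosedV
import HarnessLib

/-!
# Cell abc-stewartyu, rung A1.L (crux r2 `ArchCoreRat`), WP-L.A: the LETTER BOUND of the START's Siegel height — `log AmaxR` in closed
# form (the record's `cP`-letter for the packages)

`Summits/ABC/StewartYu/ArchG3StartLetters.lean` — cell `abc-stewartyu` (HOME `run/shared/lean/pub/abc-stewartyu/`; seat lp-1 g8).  Theorems on
`ArchG3Setup`; no definition, no named fact.  Sequel of `ArchG3StartRec` (✓): the Siegel height of the START is `P = ⌈#U·AmaxR⌉` with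
`AmaxR = max 1 (DΔC (YC c e (2sθR)) T₀ · M₀R · DmvR · e^{w₀X₀})`; here its logarithm is bounded by the record's letters, using p5's
closed-form costs `log_DΔC`, `log_WC`, `ArchSupply.log_lcm_pow_le` and `SatData.log_Dmv_le_of_weights`:

* `log_M₀R_le` — `log M₀R ≤ log 2 + (23/20)·T₀·H + [Ŝ·T₀·log 2 + H/e + L₀(1 + log(1 + 2^Ŝ X₀/H))]`;
* `log_DmvR_le` — `log DmvR ≤ 2X₀·Σⱼ(LνR 0 j/N)·Vⱼ + 2ΣⱼVⱼ` for weights `h(α°ⱼ) ≤ Vⱼ`;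
* **`log_AmaxR_le`** — `log AmaxR ≤ T₀(1 + log(1 + YC/T₀)) + [log M₀R bound] + [log DmvR bound] + w₀·X₀`.

WHAT THIS IS NOT: the comparison of these letters with the budget (record, seat p1); no crux moves.

References: Yu. V. Nesterenko, LNM 1819 (2003) §3.1 Prop. 3.1, §3.5 Lemma 3.10 (3.35)–(3.37), Lemma 3.11, Prop. 3.9 (3.48), p. 72–78
[Nesterenko2003]; Yu. Nesterenko, M. Waldschmidt (1996) §4 (4.2) (ψ(H) ≤ 1.15 H) [NesterenkoWaldschmidt1996].
-/

noncomputable section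

open Finset Real
open scoped Nat
open Summit.ABC.StewartYu.ArchSupply (WC WC_nonneg log_lcm_pow_le log_WC)

namespace Summit.ABC.StewartYu

namespace ArchG3Setup

variable {S : ArchG3Setup}

/-- **`log M₀R`**: `M₀R = ⌈ν(H)^{T₀}·WC H Ŝ L₀ T₀ X₀⌉ ≤ 2·ν(H)^{T₀}·WC`, so
`log M₀R ≤ log 2 + (23/20)·T₀·H + (Ŝ·T₀)·log 2 + H/e + L₀·(1 + log(1 + 2^Ŝ·X₀/H))`. [cite: Nesterenko2003, §3.1 Prop. 3.1, §3.5 (3.35); shape only] -/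
theorem log_M₀R_le (P : ArchG3Rec S.n) :
    Real.log (S.M₀R P : ℝ) ≤ Real.log 2 + 23 / 20 * (P.Tf 0 0) * P.H +
      (((P.Sd * P.Tf 0 0 : ℕ) : ℝ) * Real.log 2 + P.H / Real.exp 1 + P.L₀ * (1 + Real.log (1 + (2 : ℝ) ^ P.Sd * (P.Nf 0 0 : ℝ) / P.H))) := by
  have hH : 1 ≤ P.H := le_max_left _ _
  set A : ℝ := ((Nat.lcmUpto P.H : ℝ) ^ P.Tf 0 0) * WC P.H P.Sd P.L₀ (P.Tf 0 0) (P.Nf 0 0 : ℝ) with hA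
  have hν1 : (1 : ℝ) ≤ (Nat.lcmUpto P.H : ℝ) ^ P.Tf 0 0 := one_le_pow₀ (by exact_mod_cast Nat.lcmUpto_pos P.H)
  have hWC1 : 1 ≤ WC P.H P.Sd P.L₀ (P.Tf 0 0) (P.Nf 0 0 : ℝ) := by
    unfold WC
    have h1 : (1 : ℝ) ≤ (2 : ℝ) ^ (P.Sd * P.Tf 0 0) := one_le_pow₀ (by norm_num)
    have h2 : (1 : ℝ) ≤ Real.exp (P.H / Real.exp 1) := Real.one_le_exp (by positivity)
    have h3 : (1 : ℝ) ≤ (Real.exp 1 * (1 + (2 : ℝ) ^ P.Sd * (P.Nf 0 0 : ℝ) / P.H)) ^ P.L₀ := by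
      refine one_le_pow₀ ?_
      have he : (1 : ℝ) ≤ Real.exp 1 := Real.one_le_exp (by norm_num)
      have : (0 : ℝ) ≤ (2 : ℝ) ^ P.Sd * (P.Nf 0 0 : ℝ) / P.H := by positivity
      nlinarith
    calc (1 : ℝ) = 1 * (1 * 1) := by ring
      _ ≤ _ := mul_le_mul h1 (mul_le_mul h2 h3 zero_le_one (by positivity)) (by norm_num) (by positivity)
  have hA1 : 1 ≤ A := by rw [hA]; exact one_le_mul_of_one_le_of_one_le hν1 hWC1
  have hM : (S.M₀R P : ℝ) ≤ 2 * A := by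
    have h1 : (S.M₀R P : ℝ) < A + 1 := by unfold M₀R; rw [← hA]; exact Int.ceil_lt_add_one A
    linarith
  have hM0 : (0 : ℝ) < (S.M₀R P : ℝ) := by
    have h1 : A ≤ (S.M₀R P : ℝ) := by unfold M₀R; rw [← hA]; exact Int.le_ceil A
    linarith
  calc Real.log (S.M₀R P : ℝ) ≤ Real.log (2 * A) := Real.log_le_log hM0 hM
    _ = Real.log 2 + (Real.log ((Nat.lcmUpto P.H : ℝ) ^ P.Tf 0 0) + Real.log (WC P.H P.Sd P.L₀ (P.Tf 0 0) (P.Nf 0 0 : ℝ))) := by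
        rw [Real.log_mul (by norm_num) (by linarith), hA, Real.log_mul (by positivity) (by linarith)]
    _ ≤ Real.log 2 + (23 / 20 * (P.Tf 0 0) * P.H +
        (((P.Sd * P.Tf 0 0 : ℕ) : ℝ) * Real.log 2 + P.H / Real.exp 1 + P.L₀ * (1 + Real.log (1 + (2 : ℝ) ^ P.Sd * (P.Nf 0 0 : ℝ) / P.H)))) := by
        have h1 := log_lcm_pow_le P.H (P.Tf 0 0)
        push_cast at h1
        have h2 := log_WC hH P.Sd P.L₀ (P.Tf 0 0) (ρ := (P.Nf 0 0 : ℝ)) (by positivity)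
        rw [h2]
        linarith
    _ = _ := by ring

/-- **`log DmvR`**: the largest virtual monomial denominator over `|x| ≤ X₀` costs `≤ 2X₀·Σⱼ(LνR 0 j/N)·Vⱼ + 2ΣⱼVⱼ` (`h(α°ⱼ) ≤ Vⱼ`).
[cite: Nesterenko2003, §3.5 Lemma 3.11 (3.42); shape only] -/
theorem log_DmvR_le (F : S.SatData) (P : ArchG3Rec S.n) {V : Fin S.n → ℝ} (hV : ∀ j, Height.logHeight₁ (F.αo j) ≤ V j) :
    Real.log (S.DmvR F P : ℝ) ≤ 2 * (P.Nf 0 0 : ℝ) * ∑ j, ((S.LνR P 0 j : ℝ) / F.N) * V j + 2 * ∑ j, V j := by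
  classical
  obtain ⟨x, hx, hsup⟩ := Finset.exists_mem_eq_sup' (s := Finset.Icc (-(P.Nf 0 0 : ℤ)) (P.Nf 0 0))
    ⟨0, by simp⟩ (fun x => F.Dmv (S.LνR P 0) x)
  have e : S.DmvR F P = F.Dmv (S.LνR P 0) x := by unfold DmvR; exact hsup
  rw [e]
  refine (F.log_Dmv_le_of_weights (S.LνR P 0) x hV).trans ?_
  rw [mem_Icc] at hx
  have hxR : |(x : ℝ)| ≤ (P.Nf 0 0 : ℝ) := by
    rw [abs_le]; constructor <;> [exact_mod_cast hx.1; exact_mod_cast hx.2]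
  have hS : 0 ≤ ∑ j, ((S.LνR P 0 j : ℝ) / F.N) * V j :=
    sum_nonneg fun j _ => mul_nonneg (div_nonneg (Nat.cast_nonneg _) (Nat.cast_nonneg _))
      ((Height.zero_le_logHeight₁ _).trans (hV j))
  nlinarith

/-- **`log AmaxR` IN LETTERS**: `log AmaxR ≤ T₀(1 + log(1 + YC/T₀)) + [log M₀R] + [log DmvR] + w₀·X₀` with the two bracketed bounds of
`log_M₀R_le` / `log_DmvR_le` (`YC = YC (cl 0) (el 0) (2·sθR)`; so `log ⌈#U·AmaxR⌉ ≤ log(2#U) + this`). [cite: Nesterenko2003, §3.5 (3.37),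
Prop. 3.9 (3.48); shape only] -/
theorem log_AmaxR_le (F : S.SatData) (P : ArchG3Rec S.n) (c : ℤ) (e : Fin S.n → ℤ) {V : Fin S.n → ℝ}
    (hV : ∀ j, Height.logHeight₁ (F.αo j) ≤ V j) :
    Real.log (S.AmaxR F P c e) ≤
      (P.Tf 0 0 : ℝ) * (1 + Real.log (1 + S.YC c e (fun j => 2 * S.sθR F P j) / (P.Tf 0 0 : ℕ))) +
      (Real.log 2 + 23 / 20 * (P.Tf 0 0) * P.H +
        (((P.Sd * P.Tf 0 0 : ℕ) : ℝ) * Real.log 2 + P.H / Real.exp 1 + P.L₀ * (1 + Real.log (1 + (2 : ℝ) ^ P.Sd * (P.Nf 0 0 : ℝ) / P.H)))) +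
      (2 * (P.Nf 0 0 : ℝ) * ∑ j, ((S.LνR P 0 j : ℝ) / F.N) * V j + 2 * ∑ j, V j) +
      P.wl 0 * (P.Nf 0 0 : ℕ) := by
  have hY : 0 ≤ S.YC c e (fun j => 2 * S.sθR F P j) := S.YC_nonneg _ _ _
  set D : ℝ := DΔC (S.YC c e fun j => 2 * S.sθR F P j) (P.Tf 0 0) with hD
  have hD1 : 1 ≤ D := by
    rw [hD]; unfold DΔC
    refine one_le_pow₀ ?_
    have he : (1 : ℝ) ≤ Real.exp 1 := Real.one_le_exp (by norm_num)
    have : (0 : ℝ) ≤ S.YC c e (fun j => 2 * S.sθR F P j) / (P.Tf 0 0 : ℕ) := by positivity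
    nlinarith
  have hM1 : (1 : ℝ) ≤ (S.M₀R P : ℝ) := by
    have hν1 : (1 : ℝ) ≤ (Nat.lcmUpto P.H : ℝ) ^ P.Tf 0 0 := one_le_pow₀ (by exact_mod_cast Nat.lcmUpto_pos P.H)
    have hW0 := WC_nonneg P.H P.Sd P.L₀ (P.Tf 0 0) (ρ := (P.Nf 0 0 : ℝ)) (by positivity)
    have h1 : ((Nat.lcmUpto P.H : ℝ) ^ P.Tf 0 0) * WC P.H P.Sd P.L₀ (P.Tf 0 0) (P.Nf 0 0 : ℝ) ≤ (S.M₀R P : ℝ) := by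
      unfold M₀R; exact Int.le_ceil _
    -- `WC ≥ 1` as in `log_M₀R_le`
    have hWC1 : 1 ≤ WC P.H P.Sd P.L₀ (P.Tf 0 0) (P.Nf 0 0 : ℝ) := by
      unfold WC
      have h1 : (1 : ℝ) ≤ (2 : ℝ) ^ (P.Sd * P.Tf 0 0) := one_le_pow₀ (by norm_num)
      have h2 : (1 : ℝ) ≤ Real.exp (P.H / Real.exp 1) := Real.one_le_exp (by positivity)
      have h3 : (1 : ℝ) ≤ (Real.exp 1 * (1 + (2 : ℝ) ^ P.Sd * (P.Nf 0 0 : ℝ) / P.H)) ^ P.L₀ := by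
        refine one_le_pow₀ ?_
        have he : (1 : ℝ) ≤ Real.exp 1 := Real.one_le_exp (by norm_num)
        have : (0 : ℝ) ≤ (2 : ℝ) ^ P.Sd * (P.Nf 0 0 : ℝ) / P.H := by positivity
        nlinarith
      calc (1 : ℝ) = 1 * (1 * 1) := by ring
        _ ≤ _ := mul_le_mul h1 (mul_le_mul h2 h3 zero_le_one (by positivity)) (by norm_num) (by positivity)
    exact le_trans (one_le_mul_of_one_le_of_one_le hν1 hWC1) h1
  have hDm1 : (1 : ℝ) ≤ (S.DmvR F P : ℝ) := by
    have h0 : (0 : ℤ) ∈ Finset.Icc (-(P.Nf 0 0 : ℤ)) (P.Nf 0 0) := by simp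
    have h1 : F.Dmv (S.LνR P 0) 0 ≤ S.DmvR F P := by unfold DmvR; exact Finset.le_sup' (fun x => F.Dmv (S.LνR P 0) x) h0
    exact_mod_cast le_trans (F.one_le_Dmv _ 0) h1
  have hE1 : 1 ≤ Real.exp (P.wl 0 * (P.Nf 0 0 : ℕ)) := Real.one_le_exp (by have := (P.wl_facts 0).2; positivity)
  -- `AmaxR = max 1 (D · M₀R · DmvR · e^{w₀X₀})` and the product is `≥ 1`
  have hprod1 : 1 ≤ D * (S.M₀R P : ℝ) * (S.DmvR F P : ℝ) * Real.exp (P.wl 0 * (P.Nf 0 0 : ℕ)) :=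
    one_le_mul_of_one_le_of_one_le (one_le_mul_of_one_le_of_one_le (one_le_mul_of_one_le_of_one_le hD1 hM1) hDm1) hE1
  have hAeq : S.AmaxR F P c e = D * (S.M₀R P : ℝ) * (S.DmvR F P : ℝ) * Real.exp (P.wl 0 * (P.Nf 0 0 : ℕ)) := by
    unfold AmaxR; rw [← hD]; exact max_eq_right hprod1
  rw [hAeq, Real.log_mul (by positivity) (by positivity), Real.log_mul (by positivity) (by positivity),
    Real.log_mul (by positivity) (by positivity), Real.log_exp, hD, log_DΔC hY]
  have h1 := S.log_M₀R_le P
  have h2 := S.log_DmvR_le F P hV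
  linarith

end ArchG3Setup

end Summit.ABC.StewartYu

end
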